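import Summits.Ventures.DiscreteObjects.PP12.FlagTenShape

/-!
# Index sets of the `f = 7` flag-cell orbit matrix: cardinalities and the two c-line / l-point orbits (kernel; Step A of the FlagSevenOrbitReduction roadmap)
Framing: lottery ticket; floor = certified bounds/negative ranges.

Cell pub-namedobj (venture DiscreteObjects), target (M), designs gen 14; sibling of `FlagTenIndexSets` / `FlagTenShape` (`f = 10`). Setting:
projective plane of order 12, collineation `σ` with `σ³ = 1` of flag type (all fixed points on the fixed line `l`, all fixed lines through
the fixed point `c ∈ l`) with exactly 7 fixed points (`ρ = 2` sub-cell of designs g12 FAMILY-FLAG7; typed statement `FlagSevenOrbitMatrix`,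
p327216). The index sets of `FlagSevenOrbitData` are identified here:
* `card_clines_not_fixed_seven` — exactly six lines through `c` are not fixed; `exists_second_cline` — besides the orbit of a non-fixed
  `u₀ ∋ c` there is a non-fixed `u₁ ∋ c` outside `orb3 u₀`, and (`cline_mem_orb3_or`) every non-fixed line through `c` lies in
  `orb3 u₀` or in `orb3 u₁` (the two c-line orbits `Γ₀, Γ₁`, index `Fin 2`), never in both (`orb3_clines_disjoint`);
* `card_lpoints_not_fixed_seven`, `card_lpointOrbits_eq_two` — the six non-fixed points of `l` form two orbits `Z₀, Z₁` (index `Fin 2`);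
* `card_fixed_ne_eq_six` — six fixed lines `≠ l`, six fixed points `≠ c` (index `Fin 6`); the four orbits on each `m_j` / through each `y_k`
  are `FlagTenIndexSets.card_orbits_on_fixedLine_eq_four` / `card_lineOrbits_through_fixedPoint_eq_four` (valid for every `f`);
* `exterior_orbit_meets_clines` — the orbit-triangle of every exterior point has a vertex on `u₀` or on `u₁` (the class `s` of the
  triangle), and (`not_both_classes`) not on both: the triangles are indexed by the `2 · 12` points `≠ c` of `u₀, u₁`;
* `exists_cline_not_fixed_seven` — a non-fixed line through `c` exists.
No `sorry`, no new axioms.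
-/

namespace Summit.Ventures.DiscreteObjects.PP12

open Configuration Finset
open scoped Classical

namespace Collineation

variable {P L : Type*} [Membership P L] [ProjectivePlane P L] [Fintype P] [Fintype L] (σ : Collineation P L)

section Flag

variable {l : L} {c : P} (hl : σ.onLines l = l) (hc : σ.onPoints c = c) (hcl : c ∈ l)
  (hP : ∀ p : P, σ.onPoints p = p → p ∈ l) (hL : ∀ m : L, σ.onLines m = m → c ∈ m)
  (h12 : ProjectivePlane.order P L = 12)

include hL h12 in
/-- **Exactly six lines through `c` are not fixed** (`f = 7`; all fixed lines pass through `c`). -/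
theorem card_clines_not_fixed_seven (hf : fixedCard σ.onPoints = 7) :
    (univ.filter fun u : L => c ∈ u ∧ σ.onLines u ≠ u).card = 6 := by
  have hall : (univ.filter fun u : L => c ∈ u).card = 13 := by rw [card_lines_through, h12]
  have hfix : (univ.filter fun u : L => σ.onLines u = u).card = 7 := by
    change fixedCard σ.onLines = 7; rw [← σ.fixedCard_points_eq_lines, hf]
  have hsplit := Finset.card_filter_add_card_filter_not (s := univ.filter fun u : L => c ∈ u) (fun u => σ.onLines u = u)
  rw [Finset.filter_filter, Finset.filter_filter, hall] at hsplit
  have h1 : (univ.filter fun u : L => c ∈ u ∧ σ.onLines u = u) = univ.filter fun u : L => σ.onLines u = u := by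
    ext u; simp only [mem_filter, mem_univ, true_and]; exact ⟨fun h => h.2, fun h => ⟨hL u h, h⟩⟩
  have h2 : (univ.filter fun u : L => c ∈ u ∧ σ.onLines u ≠ u) = univ.filter fun u : L => c ∈ u ∧ ¬ σ.onLines u = u := rfl
  rw [h1, hfix] at hsplit
  rw [h2]; omega

include hc hL h12 in
/-- **The non-fixed lines through `c` form two orbits** (`f = 7`, `σ³ = 1`): `3 · #orbits = 6`. -/
theorem card_clineOrbits_eq_two (hq : σ.onPoints ^ 3 = 1) (hf : fixedCard σ.onPoints = 7) :
    ((univ.filter fun u : L => c ∈ u ∧ σ.onLines u ≠ u).image (orb3 σ.onLines)).card = 2 := by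
  have hqL : σ.onLines ^ 3 = 1 := σ.onLines_pow_eq_one hq
  have hcσ : ∀ v : L, c ∈ v → c ∈ σ.onLines v := fun v hv => by have := σ.mem_map hv; rwa [hc] at this
  have hS : ∀ u ∈ (univ.filter fun u : L => c ∈ u ∧ σ.onLines u ≠ u), σ.onLines u ∈ (univ.filter fun u : L => c ∈ u ∧ σ.onLines u ≠ u) := by
    intro u hu; rw [mem_filter] at hu ⊢
    exact ⟨mem_univ _, hcσ u hu.2.1, fun e => hu.2.2 (σ.onLines.injective e)⟩
  have hnf : ∀ u ∈ (univ.filter fun u : L => c ∈ u ∧ σ.onLines u ≠ u), σ.onLines u ≠ u := fun u hu => (mem_filter.1 hu).2.2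
  have h := card_image_orb3 σ.onLines hqL _ hS hnf
  rw [σ.card_clines_not_fixed_seven hL h12 hf] at h
  omega

include hL h12 in
/-- **A second c-line orbit exists** (`f = 7`): for a non-fixed `u₀` there is a non-fixed `u₁ ∋ c` outside `orb3 u₀`. -/
theorem exists_second_cline (hq : σ.onPoints ^ 3 = 1) (hf : fixedCard σ.onPoints = 7) {u₀ : L} (hu₀ : σ.onLines u₀ ≠ u₀) :
    ∃ u₁ : L, c ∈ u₁ ∧ σ.onLines u₁ ≠ u₁ ∧ u₁ ∉ orb3 σ.onLines u₀ := by
  have hqL : σ.onLines ^ 3 = 1 := σ.onLines_pow_eq_one hq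
  by_contra h
  push Not at h
  -- every non-fixed c-line lies in orb3 u₀, which has three elements; but there are six
  have hsub : (univ.filter fun u : L => c ∈ u ∧ σ.onLines u ≠ u) ⊆ orb3 σ.onLines u₀ := by
    intro u hu; rw [mem_filter] at hu; exact h u hu.2.1 hu.2.2
  have := card_le_card hsub
  rw [σ.card_clines_not_fixed_seven hL h12 hf, card_orb3_of_ne _ hqL hu₀] at this
  omega

/-- Two orbits (`σ³ = 1`) are disjoint as soon as one representative is outside the other orbit. -/
theorem orb3_clines_disjoint (hq : σ.onPoints ^ 3 = 1) {u₀ u₁ : L} (h01 : u₁ ∉ orb3 σ.onLines u₀) {u : L}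
    (hu0 : u ∈ orb3 σ.onLines u₀) (hu1 : u ∈ orb3 σ.onLines u₁) : False := by
  have hqL : σ.onLines ^ 3 = 1 := σ.onLines_pow_eq_one hq
  apply h01
  rw [← orb3_eq_of_mem σ.onLines hqL hu0, orb3_eq_of_mem σ.onLines hqL hu1]
  exact self_mem_orb3 _ _

include hc hL h12 in
/-- **The two c-line orbits exhaust the non-fixed lines through `c`** (`f = 7`): for `u₁ ∉ orb3 u₀` (both non-fixed, through `c`), every
non-fixed line through `c` lies in `orb3 u₀` or in `orb3 u₁`. -/
theorem cline_mem_orb3_or (hq : σ.onPoints ^ 3 = 1) (hf : fixedCard σ.onPoints = 7) {u₀ u₁ : L} (hcu₀ : c ∈ u₀) (hu₀ : σ.onLines u₀ ≠ u₀)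
    (hcu₁ : c ∈ u₁) (hu₁ : σ.onLines u₁ ≠ u₁) (h01 : u₁ ∉ orb3 σ.onLines u₀) {u : L} (hcu : c ∈ u) (hu : σ.onLines u ≠ u) :
    u ∈ orb3 σ.onLines u₀ ∨ u ∈ orb3 σ.onLines u₁ := by
  have hqL : σ.onLines ^ 3 = 1 := σ.onLines_pow_eq_one hq
  set U : Finset L := univ.filter fun u : L => c ∈ u ∧ σ.onLines u ≠ u with hU
  have hU6 : U.card = 6 := σ.card_clines_not_fixed_seven hL h12 hf
  have hcσ : ∀ v : L, c ∈ v → c ∈ σ.onLines v := fun v hv => by have := σ.mem_map hv; rwa [hc] at this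
  have hnfσ : ∀ v : L, σ.onLines v ≠ v → σ.onLines (σ.onLines v) ≠ σ.onLines v := fun v hv e => hv (σ.onLines.injective e)
  have horb : ∀ {v : L}, c ∈ v → σ.onLines v ≠ v → orb3 σ.onLines v ⊆ U := by
    intro v hcv hv w hw; rw [mem_orb3] at hw; rw [hU, mem_filter]
    rcases hw with rfl | rfl | rfl
    · exact ⟨mem_univ _, hcv, hv⟩
    · exact ⟨mem_univ _, hcσ _ hcv, hnfσ _ hv⟩
    · exact ⟨mem_univ _, hcσ _ (hcσ _ hcv), hnfσ _ (hnfσ _ hv)⟩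
  have hsub : orb3 σ.onLines u₀ ∪ orb3 σ.onLines u₁ ⊆ U := union_subset (horb hcu₀ hu₀) (horb hcu₁ hu₁)
  have hdisj : Disjoint (orb3 σ.onLines u₀) (orb3 σ.onLines u₁) := by
    rw [Finset.disjoint_left]; intro w hw0 hw1; exact σ.orb3_clines_disjoint hq h01 hw0 hw1
  have hcard : (orb3 σ.onLines u₀ ∪ orb3 σ.onLines u₁).card = 6 := by
    rw [card_union_of_disjoint hdisj, card_orb3_of_ne _ hqL hu₀, card_orb3_of_ne _ hqL hu₁]
  have heq : orb3 σ.onLines u₀ ∪ orb3 σ.onLines u₁ = U := Finset.eq_of_subset_of_card_le hsub (by rw [hU6, hcard])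
  have huU : u ∈ U := by rw [hU, mem_filter]; exact ⟨mem_univ _, hcu, hu⟩
  rw [← heq, mem_union] at huU
  exact huU

include hP h12 in
/-- **Exactly six points of `l` are not fixed** (`f = 7`; dual of `card_clines_not_fixed_seven`). -/
theorem card_lpoints_not_fixed_seven (hf : fixedCard σ.onPoints = 7) :
    (univ.filter fun p : P => p ∈ l ∧ σ.onPoints p ≠ p).card = 6 := by
  have hqd : ProjectivePlane.order (Dual L) (Dual P) = 12 := by rw [ProjectivePlane.Dual.order]; exact h12
  have hf' : fixedCard σ.dual.onPoints = 7 := by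
    change fixedCard σ.onLines = 7; rw [← σ.fixedCard_points_eq_lines]; exact hf
  exact σ.dual.card_clines_not_fixed_seven (c := (l : Dual L)) hP hqd hf'

include hl hP h12 in
/-- **The non-fixed points of `l` form two orbits `Z₀, Z₁`** (`f = 7`, `σ³ = 1`). -/
theorem card_lpointOrbits_eq_two (hq : σ.onPoints ^ 3 = 1) (hf : fixedCard σ.onPoints = 7) :
    ((univ.filter fun p : P => p ∈ l ∧ σ.onPoints p ≠ p).image (orb3 σ.onPoints)).card = 2 := by
  have hS : ∀ p ∈ (univ.filter fun p : P => p ∈ l ∧ σ.onPoints p ≠ p), σ.onPoints p ∈ (univ.filter fun p : P => p ∈ l ∧ σ.onPoints p ≠ p) := by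
    intro p hp; rw [mem_filter] at hp ⊢
    exact ⟨mem_univ _, (σ.mem_fixedLine_iff hl p).2 hp.2.1, fun e => hp.2.2 (σ.onPoints.injective e)⟩
  have hnf : ∀ p ∈ (univ.filter fun p : P => p ∈ l ∧ σ.onPoints p ≠ p), σ.onPoints p ≠ p := fun p hp => (mem_filter.1 hp).2.2
  have h := card_image_orb3 σ.onPoints hq _ hS hnf
  rw [σ.card_lpoints_not_fixed_seven hP h12 hf] at h
  omega

omit [ProjectivePlane P L] [Fintype L] in
/-- The orbit of a non-fixed point of `l` is one of the orbits of non-fixed points of `l` (membership in the index set of `Z_t`), and so is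
the orbit of the `l`-point of any line without fixed points. -/
theorem lpointOrbit_mem {z : P} (hzl : z ∈ l) (hz : σ.onPoints z ≠ z) :
    orb3 σ.onPoints z ∈ (univ.filter fun p : P => p ∈ l ∧ σ.onPoints p ≠ p).image (orb3 σ.onPoints) :=
  mem_image.2 ⟨z, mem_filter.2 ⟨mem_univ _, hzl, hz⟩, rfl⟩

/-- Order 12, `f = 7`: six fixed lines `≠ l` and six fixed points `≠ c` (the index sets `Fin 6`). -/
theorem card_fixed_ne_eq_six (hf : fixedCard σ.onPoints = 7) (hl : σ.onLines l = l) (hc : σ.onPoints c = c) :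
    (univ.filter fun m : L => σ.onLines m = m ∧ m ≠ l).card = 6 ∧ (univ.filter fun p : P => σ.onPoints p = p ∧ p ≠ c).card = 6 := by
  rw [σ.card_fixedLines_ne hl, σ.card_fixedPoints_ne hc, hf]; exact ⟨rfl, rfl⟩

include h12 in
/-- Order 12, `f = 7`: a non-fixed line through `c` exists. -/
theorem exists_cline_not_fixed_seven (hf : fixedCard σ.onPoints = 7) : ∃ u : L, c ∈ u ∧ σ.onLines u ≠ u :=
  σ.exists_cline_not_fixed (c := c) (by rw [hf, h12]; norm_num)

include hl hc hcl hL h12 in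
/-- **Every exterior orbit-triangle has a vertex on `u₀` or on `u₁`** (`f = 7`): the c-line of an exterior point `Q` is not fixed, hence
lies in one of the two c-line orbits, and transporting along the orbit puts a point of `orb3 Q` on `u₀` resp. `u₁`. -/
theorem exterior_orbit_meets_clines (hq : σ.onPoints ^ 3 = 1) (hf : fixedCard σ.onPoints = 7) {u₀ u₁ : L} (hcu₀ : c ∈ u₀)
    (hu₀ : σ.onLines u₀ ≠ u₀) (hcu₁ : c ∈ u₁) (hu₁ : σ.onLines u₁ ≠ u₁) (h01 : u₁ ∉ orb3 σ.onLines u₀)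
    {Q : P} (hQX : ∀ m : L, σ.onLines m = m → Q ∉ m) :
    (∃ x ∈ orb3 σ.onPoints Q, x ∈ u₀) ∨ (∃ x ∈ orb3 σ.onPoints Q, x ∈ u₁) := by
  have hQc : Q ≠ c := fun e => hQX l hl (e ▸ hcl)
  set u : L := HasLines.mkLine hQc with hu
  have hQu : Q ∈ u := (HasLines.mkLine_ax hQc).1
  have hcu : c ∈ u := (HasLines.mkLine_ax hQc).2
  have hnu : σ.onLines u ≠ u := fun e => hQX u e hQu
  have h3 : ∀ v : L, σ.onLines (σ.onLines (σ.onLines v)) = v := apply_three σ.onLines (σ.onLines_pow_eq_one hq)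
  -- transport Q along the orbit of its c-line to the representative
  have transport : ∀ {v : L}, u ∈ orb3 σ.onLines v → ∃ x ∈ orb3 σ.onPoints Q, x ∈ v := by
    intro v hmem
    rw [mem_orb3] at hmem
    rcases hmem with e | e | e
    · exact ⟨Q, self_mem_orb3 _ _, e ▸ hQu⟩
    · refine ⟨σ.onPoints (σ.onPoints Q), (mem_orb3 _ _ _).2 (Or.inr (Or.inr rfl)), ?_⟩
      have := σ.mem_map (σ.mem_map hQu); rw [e, h3] at this; exact this
    · refine ⟨σ.onPoints Q, (mem_orb3 _ _ _).2 (Or.inr (Or.inl rfl)), ?_⟩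
      have := σ.mem_map hQu; rw [e, h3] at this; exact this
  rcases σ.cline_mem_orb3_or hc hL h12 hq hf hcu₀ hu₀ hcu₁ hu₁ h01 hcu hnu with hmem | hmem
  · exact Or.inl (transport hmem)
  · exact Or.inr (transport hmem)

omit [Fintype P] [Fintype L] in
include hc in
/-- **No triangle has vertices on both `u₀` and `u₁`** (`u₁ ∉ orb3 u₀`, both through `c`, `u₀` not fixed): a point orbit meeting `u₀` in `x`
and `u₁` in `x'` would make `u₁` an image of `u₀`. -/
theorem not_both_classes (hq : σ.onPoints ^ 3 = 1) {u₀ u₁ : L} (hcu₀ : c ∈ u₀) (hu₀ : σ.onLines u₀ ≠ u₀) (hcu₁ : c ∈ u₁)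
    (h01 : u₁ ∉ orb3 σ.onLines u₀) {Q x x' : P} (hx : x ∈ orb3 σ.onPoints Q) (hxu : x ∈ u₀) (hxc : x ≠ c)
    (hx' : x' ∈ orb3 σ.onPoints Q) (hx'u : x' ∈ u₁) : False := by
  have hcσ : ∀ v : L, c ∈ v → c ∈ σ.onLines v := fun v hv => by have := σ.mem_map hv; rwa [hc] at this
  have h3 := apply_three σ.onPoints hq
  -- x' = σ^k x for some k, and σ^k u₀ ∋ c, x' is a line through c and x' ≠ c
  have hx'x : x' ∈ orb3 σ.onPoints x := by rw [orb3_eq_of_mem σ.onPoints hq hx]; exact hx'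
  have hxf : ∀ {y : P}, y ∈ orb3 σ.onPoints x → y ≠ c → ∀ {v : L}, v ∈ orb3 σ.onLines u₀ → y ∈ v → y ∈ u₁ → u₁ ∈ orb3 σ.onLines u₀ := by
    intro y _ hyc v hv hyv hyu₁
    have hcv : c ∈ v := by
      rw [mem_orb3] at hv
      rcases hv with rfl | rfl | rfl
      · exact hcu₀
      · exact hcσ _ hcu₀
      · exact hcσ _ (hcσ _ hcu₀)
    have : u₁ = v := (Nondegenerate.eq_or_eq hyu₁ hcu₁ hyv hcv).resolve_left hyc
    rw [this]; exact hv
  have hx'c : x' ≠ c := by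
    intro e
    -- c fixed, but x' ∈ orb3 x with x not fixed (x ∈ u₀ non-fixed c-line, x ≠ c … use: σ c = c ⇒ orb3 c = {c} ∌ x unless x = c)
    have hmem : x ∈ orb3 σ.onPoints x' := by rw [orb3_eq_of_mem σ.onPoints hq hx'x]; exact self_mem_orb3 _ _
    rw [e, orb3_of_fixed _ hc, mem_singleton] at hmem
    exact hxc hmem
  apply h01
  rw [mem_orb3] at hx'x
  rcases hx'x with e | e | e
  · exact hxf (self_mem_orb3 _ _) hxc (self_mem_orb3 _ _) hxu (e ▸ hx'u)
  · refine hxf ((mem_orb3 _ _ _).2 (Or.inr (Or.inl rfl))) (e ▸ hx'c) ((mem_orb3 _ _ _).2 (Or.inr (Or.inl rfl))) (σ.mem_map hxu) ?_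
    rw [← e]; exact hx'u
  · refine hxf ((mem_orb3 _ _ _).2 (Or.inr (Or.inr rfl))) (e ▸ hx'c) ((mem_orb3 _ _ _).2 (Or.inr (Or.inr rfl)))
      (σ.mem_map (σ.mem_map hxu)) ?_
    rw [← e]; exact hx'u

end Flag

end Collineation

end Summit.Ventures.DiscreteObjects.PP12
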